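import Mathlib
import Summits.KontsevichZagierPeriods.KontsevichZagierPeriods.Theorems.SoloInformedAyoubComplex
import HarnessLib
import HarnessLib.Audit

/-!
# SoloInformed — Ayoub's localised injectivity for an ARBITRARY complex symbol `θ`

`Theorems/SoloInformedAyoubComplex.lean` typed Ayoub's conjecture [Ayoub 2014, Def. 10, Prop. 11,
Rem. 13] — "`Ev : 𝒫 → ℂ` is injective, `𝒫 := 𝒫^eff[θ⁻¹]`, `Ev θ = 2πi`" — with `θ = g + i h` a
pair of ONE one-variable generators. Ayoub's `θ` is an arbitrary well-chosen element of `𝒫^eff`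
(a `ℤ`-combination of complex generators of various dimensions), and injectivity for one `θ` does
not formally transfer to another. This file removes the restriction:

* the **symbol ring**: the `Mul` instance on `Σ n, Gen n` (`a · b := a ⊠ b`, dimensions add) makes
  `SoloInformedAyoubSymbols = FreeAbelianGroup (Σ n, Gen n)` a ring
  (`FreeAbelianGroup.nonUnitalNonAssocRing`) with `[a] · [b] = [a ⊠ b]` (`soloInformedAyoubOf_mul`),
  and `⟦Ψ (x · y)⟧ = ⟦Ψ x⟧ · ⟦Ψ y⟧` for ALL symbols (`soloInformed_toFormalPeriod_psi_mul`,
  biadditivity from the generator case);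
* `SoloInformedAyoubEvInjLocSym` — the conjecture with `θ = (θ₁, θ₂)` an arbitrary pair of real
  symbols with `Ev θ₁ + i Ev θ₂ = 2πi`; the one-generator form implies it
  (`soloInformed_evInjLocSym_of_evInjLoc`, via `soloInformedMulGen_eq_mul : (· ⊠ g) = (· * [g])`);
* `soloInformed_ayoubKZLoc_of_evInjLocSym : AyoubEvInjLocSym → AyoubKZLoc` — the same
  `Ψ ⊗ ℤ[i]` push-forward (`Ev (G + iH)^N = (2πi)^N ≠ 0`), now with `G = ⟦Ψ θ₁⟧`, `H = ⟦Ψ θ₂⟧`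
  arbitrary (`soloInformed_evalP_toFormalPeriod_psi : evalP ⟦Ψ x⟧ = Ev x` for every symbol, all
  real symbols having real evaluation `soloInformedAyoubEv_im`);
* `soloInformed_ayoubTransferSym₈ : SeparationOfPoles → NashCubulation → AyoubEvInjLocSym → KZSat →
  KontsevichZagierPeriods`.

What remains un-typed of Ayoub's side is exactly: (0) `GPC for all Nori motives ⟹ Ev` injective on
`𝒫` [Ayoub 2014, Prop. 11 (𝒫 ≅ 𝒫(ℳ)); Huber–Müller-Stach 2017, Prop. 13.2.6]; (α) Ayoub's product
on `𝒫^eff` is `[a]·[b] = [a ⊠ b]` [Ayoub 2014, §2.2]; (β) a complex generator `F` (holomorphic on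
`D̄ⁿ`, algebraic over `ℚ(z)`) is the pair `((F + F̄)/2, (F − F̄)/2i)` of real-on-real generators and
Ayoub's relations split componentwise.

References: J. Ayoub, *Periods and the conjectures of Grothendieck and Kontsevich–Zagier*, EMS
Newsl. 91 (2014) 12–18; A. Huber, S. Müller-Stach, *Periods and Nori motives*, Springer 2017, §13.2;
M. Kontsevich, D. Zagier, *Periods* (2001), §1.2, §4.1.
-/

noncomputable section

open scoped BigOperators
open Set MeasureTheory
open Literature.NumberTheory.Transcendental Literature.NumberTheory.Transcendental.KZ

namespace Summit.KontsevichZagierPeriods.KontsevichZagierPeriods.Theorems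

/-! ### The symbol ring: `[a] · [b] = [a ⊠ b]` -/

/-- The product of generators (as elements of the `Σ`-type): dimensions add, functions multiply in
disjoint variables. This makes `SoloInformedAyoubSymbols = FreeAbelianGroup (Σ n, Gen n)` a
(non-unital, non-associative-by-definition) ring with `[a] · [b] = [a ⊠ b]`
(`FreeAbelianGroup.nonUnitalNonAssocRing`). [Ayoub 2014, §2.2] -/
instance soloInformedAyoubSigmaMul : Mul (Σ n, SoloInformedAyoubGen n) :=
  ⟨fun a b => ⟨a.1 + b.1, soloInformedGenProd a.2 b.2⟩⟩

/-- Unfolding the product of generators. -/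
theorem soloInformedAyoub_sigma_mul_def (a b : Σ n, SoloInformedAyoubGen n) :
    a * b = ⟨a.1 + b.1, soloInformedGenProd a.2 b.2⟩ := rfl

/-- `[a] · [b] = [a ⊠ b]` on symbols. [Ayoub 2014, §2.2] -/
theorem soloInformedAyoubOf_mul {n m : ℕ} (a : SoloInformedAyoubGen n) (b : SoloInformedAyoubGen m) :
    soloInformedAyoubOf a * soloInformedAyoubOf b = soloInformedAyoubOf (soloInformedGenProd a b) :=
  FreeAbelianGroup.of_mul_of _ _

/-- `(· ⊠ g) = (· * [g])`: the one-generator multiplication of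
`Theorems/SoloInformedAyoubComplex.lean` is right multiplication in the symbol ring. -/
theorem soloInformedMulGen_eq_mul (g : SoloInformedAyoubGen 1) (x : SoloInformedAyoubSymbols) :
    soloInformedMulGen g x = x * soloInformedAyoubOf g := by
  induction x using FreeAbelianGroup.induction_on with
  | zero => simp
  | of a =>
    obtain ⟨n, a⟩ := a
    change soloInformedMulGen g (soloInformedAyoubOf a) = soloInformedAyoubOf a * _
    rw [soloInformedMulGen_of, soloInformedAyoubOf_mul]
  | neg x ih => rw [map_neg, ih, neg_mul]
  | add x y hx hy => rw [map_add, hx, hy, add_mul]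

/-- **`⟦Ψ (x · y)⟧ = ⟦Ψ x⟧ · ⟦Ψ y⟧` for all symbols**: `Ψ` is a ring map into the formal period
ring (modulo the KZ moves), by biadditivity from `soloInformed_toFormalPeriod_psi_genProd`.
[Kontsevich–Zagier 2001, §4.1; Ayoub 2014, §2.2] -/
theorem soloInformed_toFormalPeriod_psi_mul (hQ : SoloInformedAyoubLemmaQ)
    (x y : SoloInformedAyoubSymbols) :
    toFormalPeriod (soloInformedAyoubPsi hQ (x * y)) =
      toFormalPeriod (soloInformedAyoubPsi hQ x) * toFormalPeriod (soloInformedAyoubPsi hQ y) := by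
  induction y using FreeAbelianGroup.induction_on with
  | zero => simp
  | of b =>
    obtain ⟨m, b⟩ := b
    induction x using FreeAbelianGroup.induction_on with
    | zero => simp
    | of a =>
      obtain ⟨n, a⟩ := a
      change toFormalPeriod (soloInformedAyoubPsi hQ (soloInformedAyoubOf a * soloInformedAyoubOf b)) =
        toFormalPeriod (soloInformedAyoubPsi hQ (soloInformedAyoubOf a)) *
          toFormalPeriod (soloInformedAyoubPsi hQ (soloInformedAyoubOf b))
      rw [soloInformedAyoubOf_mul, soloInformed_toFormalPeriod_psi_genProd]
    | neg x ih => rw [neg_mul, map_neg, map_neg, ih, map_neg, map_neg, neg_mul]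
    | add x x' hx hx' => rw [add_mul, map_add, map_add, hx, hx', map_add, map_add, add_mul]
  | neg y ih => rw [mul_neg, map_neg, map_neg, ih, map_neg, map_neg, mul_neg]
  | add y y' hy hy' => rw [mul_add, map_add, map_add, hy, hy', map_add, map_add, mul_add]

/-! ### `θ` an arbitrary complex symbol -/

/-- Multiplication by an arbitrary complex symbol `θ = (θ₁, θ₂)` ("`θ₁ + i θ₂`", `θ₁, θ₂` real
symbols) on complex symbols `(u, v)`: `θ (u + iv) = (u θ₁ − v θ₂) + i (u θ₂ + v θ₁)`.
[Ayoub 2014, §2.2, Def. 10] -/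
def soloInformedMulThetaSym (θ p : SoloInformedAyoubSymbols × SoloInformedAyoubSymbols) :
    SoloInformedAyoubSymbols × SoloInformedAyoubSymbols :=
  (p.1 * θ.1 - p.2 * θ.2, p.1 * θ.2 + p.2 * θ.1)

/-- The one-generator `θ = g + i h` is the special case `θ = ([g], [h])`. -/
theorem soloInformedMulTheta_eq_sym (g h : SoloInformedAyoubGen 1) :
    soloInformedMulTheta g h = soloInformedMulThetaSym (soloInformedAyoubOf g, soloInformedAyoubOf h) := by
  funext p
  simp [soloInformedMulTheta, soloInformedMulThetaSym, soloInformedMulGen_eq_mul]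

/-- **Ayoub's conjecture, localised at an ARBITRARY complex symbol `θ` with `Ev θ = 2πi`,
restricted to real symbols** [Ayoub 2014, Def. 10, Prop. 11, Rem. 13]: for some complex symbol
`θ = θ₁ + i θ₂` with `Ev θ = 2πi`, every real symbol `x` with `Ev x = 0` satisfies
`θ^N (k x) ∈ Rel ⊕ i Rel` for some `N` and some `k ≠ 0` — i.e. `x ↦ 0` in
`𝒫 ⊗ ℚ = (Symbols_ℂ ⧸ Rel_ℂ)[θ⁻¹] ⊗ ℚ`. This is the faithful typed form of "`Ev : 𝒫 → ℂ` is
injective on the image of the real symbols" for Ayoub's `𝒫 := 𝒫^eff[θ⁻¹]`, `θ` his well-chosen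
element (Def. 10), granted the readings (α) Ayoub's product = `⊠` and (β) complex generators =
pairs of real-on-real generators (`F = g + i h`, `g = (F + F̄)/2`). Weaker than
`SoloInformedAyoubEvInjLoc` (`soloInformed_evInjLocSym_of_evInjLoc`). OPEN; hypothesis only.
[cite: Ayoub2014, Def. 10, Prop. 11, Rem. 13] -/
@[conjecture] def SoloInformedAyoubEvInjLocSym : Prop :=
  ∃ θ : SoloInformedAyoubSymbols × SoloInformedAyoubSymbols,
    soloInformedAyoubEv θ.1 + soloInformedAyoubEv θ.2 * Complex.I = 2 * Real.pi * Complex.I ∧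
      ∀ x : SoloInformedAyoubSymbols, soloInformedAyoubEv x = 0 →
        ∃ N k : ℕ, k ≠ 0 ∧
          ((soloInformedMulThetaSym θ)^[N] (k • x, 0)).1 ∈ soloInformedAyoubRel ∧
          ((soloInformedMulThetaSym θ)^[N] (k • x, 0)).2 ∈ soloInformedAyoubRel

/-- The one-generator form implies the arbitrary-symbol form. -/
theorem soloInformed_evInjLocSym_of_evInjLoc (h : SoloInformedAyoubEvInjLoc) :
    SoloInformedAyoubEvInjLocSym := by
  obtain ⟨g, h, hθ, hinj⟩ := h
  refine ⟨(soloInformedAyoubOf g, soloInformedAyoubOf h), hθ, fun x hx => ?_⟩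
  rw [← soloInformedMulTheta_eq_sym]
  exact hinj x hx

/-- `Ψ ⊗ ℤ[i]` intertwines multiplication by an arbitrary complex symbol `θ`. -/
theorem soloInformed_toFormalPeriod_psi_mulThetaSym_iterate (hQ : SoloInformedAyoubLemmaQ)
    (θ : SoloInformedAyoubSymbols × SoloInformedAyoubSymbols) (N : ℕ)
    (p : SoloInformedAyoubSymbols × SoloInformedAyoubSymbols) :
    toFormalPeriod (soloInformedAyoubPsi hQ ((soloInformedMulThetaSym θ)^[N] p).1) =
        toFormalPeriod (soloInformedAyoubPsi hQ p.1) *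
            (soloInformedCPow (toFormalPeriod (soloInformedAyoubPsi hQ θ.1))
              (toFormalPeriod (soloInformedAyoubPsi hQ θ.2)) N).1 -
          toFormalPeriod (soloInformedAyoubPsi hQ p.2) *
            (soloInformedCPow (toFormalPeriod (soloInformedAyoubPsi hQ θ.1))
              (toFormalPeriod (soloInformedAyoubPsi hQ θ.2)) N).2 ∧
      toFormalPeriod (soloInformedAyoubPsi hQ ((soloInformedMulThetaSym θ)^[N] p).2) =
        toFormalPeriod (soloInformedAyoubPsi hQ p.1) *
            (soloInformedCPow (toFormalPeriod (soloInformedAyoubPsi hQ θ.1))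
              (toFormalPeriod (soloInformedAyoubPsi hQ θ.2)) N).2 +
          toFormalPeriod (soloInformedAyoubPsi hQ p.2) *
            (soloInformedCPow (toFormalPeriod (soloInformedAyoubPsi hQ θ.1))
              (toFormalPeriod (soloInformedAyoubPsi hQ θ.2)) N).1 := by
  induction N with
  | zero => simp [soloInformedCPow]
  | succ N ih =>
    obtain ⟨ih₁, ih₂⟩ := ih
    rw [Function.iterate_succ_apply']
    simp only [soloInformedMulThetaSym, soloInformedCPow, map_sub, map_add,
      soloInformed_toFormalPeriod_psi_mul, ih₁, ih₂]
    constructor <;> ring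

/-- Every real symbol has real evaluation. -/
theorem soloInformedAyoubEv_im (hQ : SoloInformedAyoubLemmaQ) (x : SoloInformedAyoubSymbols) :
    (soloInformedAyoubEv x).im = 0 := by
  induction x using FreeAbelianGroup.induction_on with
  | zero => simp
  | of a =>
    obtain ⟨n, a⟩ := a
    exact soloInformedAyoubEv_of_im_eq_zero a (soloInformedAyoub_continuousOn_cube hQ a)
      (soloInformedAyoub_real_cube hQ a)
  | neg x ih => rw [map_neg, Complex.neg_im, ih, neg_zero]
  | add x y hx hy => rw [map_add, Complex.add_im, hx, hy, add_zero]

/-- `evalP ⟦Ψ x⟧ = Ev x` (as complex numbers) for every symbol `x`. -/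
theorem soloInformed_evalP_toFormalPeriod_psi (hQ : SoloInformedAyoubLemmaQ)
    (x : SoloInformedAyoubSymbols) :
    ((evalP (toFormalPeriod (soloInformedAyoubPsi hQ x)) : ℝ) : ℂ) = soloInformedAyoubEv x := by
  rw [evalP_toFormalPeriod, soloInformed_eval_psi]
  apply Complex.ext
  · simp
  · rw [Complex.ofReal_im, soloInformedAyoubEv_im hQ x]

/-- **The arbitrary-`θ` localised injectivity implies the KZ-side reading.** Same push-forward
as `soloInformed_ayoubKZLoc_of_evInjLoc`, with `G = ⟦Ψ θ₁⟧`, `H = ⟦Ψ θ₂⟧`.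
[Ayoub 2014, Rem. 13; Kontsevich–Zagier 2001, §4.1] -/
theorem soloInformed_ayoubKZLoc_of_evInjLocSym (hI : SoloInformedAyoubEvInjLocSym) :
    SoloInformedAyoubKZLoc := by
  obtain ⟨θ, hθ, hinj⟩ := hI
  intro x hx
  obtain ⟨N, k, hk, h₁, h₂⟩ := hinj x hx
  haveI := soloInformed_noZeroSMulDivisors_nat
  set Ψ := soloInformedAyoubPsi soloInformed_ayoubLemmaQ with hΨ
  set G := toFormalPeriod (Ψ θ.1) with hG
  set H := toFormalPeriod (Ψ θ.2) with hH
  set X := toFormalPeriod (Ψ x) with hX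
  obtain ⟨hit₁, hit₂⟩ :=
    soloInformed_toFormalPeriod_psi_mulThetaSym_iterate soloInformed_ayoubLemmaQ θ N (k • x, 0)
  rw [← hΨ, ← hG, ← hH] at hit₁ hit₂
  simp only [map_zero, zero_mul, sub_zero, add_zero, map_nsmul] at hit₁ hit₂
  rw [toFormalPeriod_eq_zero_iff.2 (soloInformedAyoubPsi_rel _ h₁), ← hX, smul_mul_assoc,
    eq_comm, smul_eq_zero] at hit₁
  rw [toFormalPeriod_eq_zero_iff.2 (soloInformedAyoubPsi_rel _ h₂), ← hX, smul_mul_assoc,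
    eq_comm, smul_eq_zero] at hit₂
  have hA : X * (soloInformedCPow G H N).1 = 0 := hit₁.resolve_left hk
  have hB : X * (soloInformedCPow G H N).2 = 0 := hit₂.resolve_left hk
  have hev := soloInformed_evalP_cpow G H N
  rw [hG, hH, soloInformed_evalP_toFormalPeriod_psi, soloInformed_evalP_toFormalPeriod_psi,
    hθ] at hev
  have hne : ((evalP (soloInformedCPow G H N).1 : ℝ) : ℂ) +
      ((evalP (soloInformedCPow G H N).2 : ℝ) : ℂ) * Complex.I ≠ 0 := by
    rw [hev]
    exact pow_ne_zero _ (mul_ne_zero (mul_ne_zero two_ne_zero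
      (Complex.ofReal_ne_zero.2 Real.pi_ne_zero)) Complex.I_ne_zero)
  have key : ∀ C : FormalPeriodRing, evalP C ≠ 0 → X * C = 0 →
      ∃ u : FormalRep, eval u ≠ 0 ∧ u * Ψ x ∈ relations := by
    intro C hC hXC
    obtain ⟨u, rfl⟩ := toFormalPeriod_surjective C
    refine ⟨u, hC, ?_⟩
    rw [← toFormalPeriod_eq_zero_iff, map_mul, mul_comm, ← hX]
    exact hXC
  by_cases hA0 : evalP (soloInformedCPow G H N).1 = 0
  · refine key _ (fun hB0 => hne ?_) hB
    rw [hA0, hB0]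
    simp
  · exact key _ hA0 hA

/-- **Transfer chain, arbitrary-`θ` form**:
`SeparationOfPoles → NashCubulation → AyoubEvInjLocSym → KZSat → KontsevichZagierPeriods`.
[Ayoub 2014, Prop. 11, Rem. 13; Kontsevich–Zagier 2001, §1.2, §4.1] -/
theorem soloInformed_ayoubTransferSym₈ (H₂ : SoloInformedSeparationOfPoles)
    (hN : SoloInformedNashCubulation) (hI : SoloInformedAyoubEvInjLocSym)
    (hS : SoloInformedKZSat) : KontsevichZagierPeriods :=
  soloInformed_ayoubTransferLoc₈ H₂ hN (soloInformed_ayoubKZLoc_of_evInjLocSym hI) hS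

end Summit.KontsevichZagierPeriods.KontsevichZagierPeriods.Theorems
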